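import Summits.QuantumFields.BalabanUV.Beta.GAN24.WilsonSectorUndressedRow
import Literature.MathematicalPhysics.QuantumFieldTheory.Balaban1983to89.T4GaugeActionRatePair

/-!
# `BalabanUV.Beta.GAN24.WilsonSectorRow` — binder row G-an2-4 / (CONV-C), CT-ROUTE, the hS0 ASSEMBLY for the cubic-WILSON sector of (E), part B
# (row owner, `gen19/CT3-MECHANISM-v1.2.md` §B∕§C): **hS0 FOR THE WILSON LINEAGE OF THE RECURSIVE FAMILY, FROM THE CONTACT-TERM END** — given leaf-01 g58's
# CT-3c END (`ContactAssembly.exists_contact_bound`, the owner's worded shape) as the hypothesis `hCT`, the unit tables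
# `unitS (sfStep Lc j) (smStep 3 Lc j) (wilsonSecAt Lc (toSite rr) cE j)` are local stencil families with ONE constant and ONE rate for ALL levels `j`
# and all in-block roots, at the literal's pin `cE = Lc^4`

NOT IN PRINT; OUR PROOF ATTEMPT (of the route; THIS file is [folklore] bookkeeping: part A `WilsonSectorUndressedRow.exists_locStencil_wilsonUndressed_pin`
(road S3's row W in push currency), leaf-03 g52's identification `SrecWilsonSector.unitS_wilsonSecAt_succ_eq_push₃`, the END `hCT` (leaf-01 g58's
`ContactAssembly.exists_contact_bound`, kernel-checked in their joint certificate `CERT-concat-CT3c-END.v2.rc0.lean`; consumed here as a HYPOTHESIS of its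
exact shape so that this file lands independently — the one-line discharge `exists_hS0_wilsonSec` is appended when `ContactAssembly` is in the tree), the
sup-to-ℓ¹ packaging `locStencil_of_ff_bound`, and the scalar identity `|cE·(cE·Lc^8)^(k+1)|·K·(Lc^{12(k+1)})⁻¹ = Lc^4·K` at the pin).  HONEST FRAMING
(cell contract, verbatim): «discharging `BetaPertH` makes Bałaban's UV stability UNCONDITIONAL — a real constructive-QFT result; it is NOT the continuum limit
and NOT the Clay problem.»  HONEST DEPENDENCY (verbatim): «continuum YM on T⁴ ⇐ BetaPertH ∧ nine spine estimates (0/9 proved); BetaPertH ⇐ (D1) ∧ (D4) ∧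
CAP+tail; G-an2-4 gates asym, D1 and NE2/3/4.»  No cited fact, no wall binder, no `def`, no `def … : Prop`.
WHAT THIS IS AND IS NOT: it is `hSrow` (= hS0) for the cubic-WILSON sector `wilsonSecAt` of the COMB recursive family `SrecAt` (leaf-03's
`SrecAt_eq_wilsonSecAt_add_bornSecAt`), CONDITIONAL on `hCT`; it is NOT hS0 for the full `S` of (E) (the `bornSecAt` sectors — v1.2 §D (D2), leaf-02 g47's
`BorderGaugeLegContact` ∕ `HessianGaugeLegContact` cells — are the next assembly), NOT the sym family `JsB12Sym` (CT-5), NOT hSdev (CT-4).  NEVER «G-an2-4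
closed» as (CONV-C); NOT D1, NOT `BetaPertH`, NOT continuum, NOT Clay.

## What is proved
* §1 (generic `d`) **`locStencil_of_ff_bound`** (`|x|₁ ≤ (d+1)·‖x‖∞` is t4's `T4GaugeActionRatePair.l1_le_mul_supNorm`, reused) (an ff-valued stencil family whose ff entries are bounded by
  `K·e^{−κ′(‖x−u‖∞ + ‖z−u‖∞)}` is `LocStencil S K (κ′∕(d+1))`), `isFF_sub`.
* §2 (`d = 3`) **`exists_hS0_wilsonSec_of_contact`**: `2 ≤ Lc`, `cE = Lc^4`, and the contact END `hCT` (∃ κ′ K, … ∀ rr ∈ box, ∀ k κ₁ u′ x′ z′ α β,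
  `|push₃ T T T (wilsonA 3) … − push₃ B B B (wilsonA 3) …| ≤ K·(Lc^{12(k+1)})⁻¹·e^{−κ′(‖x′−u′‖∞+‖z′−u′‖∞)}`, `T = legChain (respStepBmSeq (toSite rr) Lc) 0 k`,
  `B = respStep 1 (Lc^(k+1))`) ⟹ `∃ Cs δS, 0 < δS ∧ ∀ rr ∈ box (3+1) Lc, ∀ j, LocStencil (unitS (sfStep Lc j) (smStep 3 Lc j) (wilsonSecAt Lc (toSite rr) cE j)) Cs δS`.
Unit `b2b-balaban-gan24-p1` (row owner G-an2-4, gen 19), 2026-08-21.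
-/

noncomputable section

open Finset
open scoped BigOperators
open Literature.MathematicalPhysics.QuantumFieldTheory
open Literature.MathematicalPhysics.QuantumFieldTheory.Balaban1983to89
open Literature.MathematicalPhysics.QuantumFieldTheory.Balaban1983to89.Beta
open B12Sec2to5 (l1 l1_nonneg)
open B4ContourShift (supNorm supNorm_nonneg abs_le_supNorm)
open ExpKernelCalculus (MKer)
open OneStepResolventKernel (Fib LocStencil)
open Summit.QuantumFields.BalabanUV.Beta.GAN24.Push4 (IsFF)
open StepJetData (wilsonA locStencil_wilsonA locStencil_add locStencil_smul)
open AffineAveraging (Site box toSite)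
open BalabanCompositeJets (respStep)
open Summit.QuantumFields.BalabanUV.Beta.HessKerDressedUnits (unitS locStencil_unitS)
open Summit.QuantumFields.BalabanUV.Beta.GAN24.CombesThomas (sfStep smStep)
open Summit.QuantumFields.BalabanUV.Beta.GAN24.Push4Iter (legChain)
open Summit.QuantumFields.BalabanUV.Beta.GAN24.RespStepBmDecompExact (respStepBmSeq)
open Summit.QuantumFields.BalabanUV.Beta.GAN24.Push3 (push₃ isFF_push₃)
open Summit.QuantumFields.BalabanUV.Beta.GAN24.SrecWilsonSector (wilsonSecAt wilsonSecAt_zero unitS_wilsonSecAt_succ_eq_push₃)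
open Summit.QuantumFields.BalabanUV.Beta.GAN24.StencilSlotOfShapes (locStencil_mono')
open Summit.QuantumFields.BalabanUV.Beta.GAN24.WilsonSectorUndressedRow (exists_locStencil_wilsonUndressed_pin)
open Literature.MathematicalPhysics.QuantumFieldTheory.Balaban1983to89.T4GaugeActionRatePair (l1_le_mul_supNorm)

namespace Summit.QuantumFields.BalabanUV.Beta.GAN24.WilsonSectorRow

variable {d : ℕ}

/-! ## §1 Packaging: an ff-valued family with an ℓ∞-exponential ff bound is a local stencil family -/

/-- [folklore] The difference of two ff-valued kernels is ff-valued. -/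
theorem isFF_sub {V V' : MKer (d + 1) (Fib d)} (hV : IsFF V) (hV' : IsFF V') : IsFF (V - V') :=
  ⟨fun x z μ b => by rw [Pi.sub_apply, Pi.sub_apply, Pi.sub_apply, Pi.sub_apply, hV.1, hV'.1, sub_zero],
    fun x z a ν => by rw [Pi.sub_apply, Pi.sub_apply, Pi.sub_apply, Pi.sub_apply, hV.2, hV'.2, sub_zero]⟩

/-- [folklore] **AN ff-VALUED STENCIL FAMILY WITH AN ℓ∞-EXPONENTIAL BOUND ON ITS ff ENTRIES IS A LOCAL STENCIL FAMILY** at rate `κ′∕(d+1)`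
(`|x|₁ ≤ (d+1)‖x‖∞`; the non-ff entries vanish). -/
theorem locStencil_of_ff_bound {S : Fin (d + 1) → (Fin (d + 1) → ℤ) → MKer (d + 1) (Fib d)} (hff : ∀ κ u, IsFF (S κ u)) {K κ' : ℝ}
    (hK : 0 ≤ K) (hκ : 0 ≤ κ')
    (hb : ∀ (κ : Fin (d + 1)) (u x z : Fin (d + 1) → ℤ) (α β : Fin (d + 1)),
      |S κ u x z (Sum.inl α) (Sum.inl β)| ≤ K * Real.exp (-(κ' * (supNorm (x - u) + supNorm (z - u))))) :
    LocStencil S K (κ' / ((d : ℝ) + 1)) := by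
  have hd : (0 : ℝ) < (d : ℝ) + 1 := by positivity
  intro κ u x z a b
  have hpos : 0 ≤ K * Real.exp (-(κ' / ((d : ℝ) + 1)) * (l1 (x - u) + l1 (z - u))) := by positivity
  rcases a with α | μ
  · rcases b with β | ν
    · refine (hb κ u x z α β).trans (mul_le_mul_of_nonneg_left (Real.exp_le_exp.2 ?_) hK)
      have h1 := l1_le_mul_supNorm (x - u)
      have h2 := l1_le_mul_supNorm (z - u)
      rw [neg_mul, neg_le_neg_iff, div_mul_eq_mul_div, div_le_iff₀ hd]
      nlinarith [supNorm_nonneg (x - u), supNorm_nonneg (z - u)]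
    · rw [(hff κ u).2]; simpa using hpos
  · rw [(hff κ u).1]; simpa using hpos

/-! ## §2 `d = 3`: hS0 for the Wilson lineage, from the contact-term END -/

section Four

variable {Lc : ℕ} [NeZero Lc]

/-- NOT IN PRINT; OUR PROOF ATTEMPT.  **hS0 FOR THE CUBIC-WILSON SECTOR OF THE RECURSIVE FAMILY (E), FROM THE CONTACT-TERM END** (`d = 3`, `2 ≤ Lc`, the
literal's pin `cE = Lc^4`): IF the contact term of the dressed Wilson push is main order with exponential spread (`hCT` = leaf-01 g58's
`ContactAssembly.exists_contact_bound`, VERBATIM shape), THEN the unit tables of the Wilson lineage `wilsonSecAt` of leaf-10's `SrecAt` are LOCAL STENCIL FAMILIES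
WITH ONE CONSTANT AND ONE RATE FOR ALL LEVELS `j` and all in-block roots — the letter `hSrow` of road FP's LEFT END, restricted to the Wilson sector of the comb family.
Route: member `0` by lit `locStencil_wilsonA` + units; member `k+1` = `w_k • push₃ T T T W` (leaf-03) `= w_k • push₃ B B B W + w_k • (contact)`; the first by part A
(road S3's row W, `Lc^4 •`), the second by `hCT` with `|w_k|·K·(Lc^{12(k+1)})⁻¹ = Lc^4·K`. -/
theorem exists_hS0_wilsonSec_of_contact (hLc : 2 ≤ Lc) {cE : ℝ} (hcE : cE = (Lc : ℝ) ^ (3 + 1))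
    (hCT : ∃ κ' K : ℝ, 0 < κ' ∧ 0 ≤ K ∧ ∀ (rr : Fin (3 + 1) → ℕ), rr ∈ box (3 + 1) Lc →
      ∀ (k : ℕ) (κ₁ : Fin (3 + 1)) (u' x' z' : Site (3 + 1)) (α β : Fin (3 + 1)),
        |push₃ (legChain (respStepBmSeq (d := 3) (toSite rr) Lc) 0 k) (legChain (respStepBmSeq (d := 3) (toSite rr) Lc) 0 k)
            (legChain (respStepBmSeq (d := 3) (toSite rr) Lc) 0 k) (wilsonA 3) κ₁ u' x' z' (Sum.inl α) (Sum.inl β)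
          - push₃ (respStep (d := 3) 1 (Lc ^ (k + 1))) (respStep (d := 3) 1 (Lc ^ (k + 1))) (respStep (d := 3) 1 (Lc ^ (k + 1)))
            (wilsonA 3) κ₁ u' x' z' (Sum.inl α) (Sum.inl β)|
          ≤ K * ((Lc : ℝ) ^ (12 * (k + 1)))⁻¹ * Real.exp (-(κ' * (supNorm (x' - u') + supNorm (z' - u'))))) :
    ∃ Cs δS : ℝ, 0 < δS ∧ ∀ (rr : Fin (3 + 1) → ℕ), rr ∈ box (3 + 1) Lc →
      ∀ j : ℕ, LocStencil (unitS (sfStep Lc j) (smStep 3 Lc j) (wilsonSecAt Lc (toSite rr) cE j)) Cs δS := by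
  have hL : (0 : ℝ) < (Lc : ℝ) := by exact_mod_cast Nat.pos_of_ne_zero (NeZero.ne Lc)
  obtain ⟨κ', K, hκ', hK, hC⟩ := hCT
  obtain ⟨CA, δA, hδA, hA⟩ := exists_locStencil_wilsonUndressed_pin (Lc := Lc) hcE
  -- member `0`: `unitS 1 1 (cE • wilsonA)`, local at rate `1`
  have h0 : LocStencil (unitS (sfStep Lc 0) (smStep 3 Lc 0) (fun κ' u' => cE • wilsonA 3 κ' u')) _ 1 :=
    locStencil_unitS (locStencil_smul cE (locStencil_wilsonA (d := 3) zero_le_one))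
  set C0 : ℝ := |(sfStep Lc 0 * smStep 3 Lc 0)⁻¹| * (max |(sfStep Lc 0)⁻¹| |(smStep 3 Lc 0)⁻¹| * (|cE| * _) *
    max |(sfStep Lc 0)⁻¹| |(smStep 3 Lc 0)⁻¹|) with hC0
  have hCA : 0 ≤ CA := ((hA 0) 0 0).nonneg (Sum.inl 0)
  -- constants: one rate below `δA`, `κ′∕4`, `1`; one constant above all three
  set δS : ℝ := min (min δA (κ' / ((3 : ℝ) + 1))) 1 with hδS
  have hδS0 : 0 < δS := lt_min (lt_min hδA (by positivity)) one_pos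
  have hδS_A : δS ≤ δA := (min_le_left _ _).trans (min_le_left _ _)
  have hδS_κ : δS ≤ κ' / ((3 : ℝ) + 1) := (min_le_left _ _).trans (min_le_right _ _)
  have hδS_1 : δS ≤ 1 := min_le_right _ _
  refine ⟨max (CA + (Lc : ℝ) ^ (3 + 1) * K) C0, δS, hδS0, fun rr hrr j => ?_⟩
  cases j with
  | zero =>
    rw [wilsonSecAt_zero]
    exact locStencil_mono' h0 (le_max_right _ _) hδS_1
  | succ k =>
    rw [unitS_wilsonSecAt_succ_eq_push₃ hrr cE k]
    set w : ℝ := cE * (cE * (Lc : ℝ) ^ (2 * (3 + 1))) ^ (k + 1) with hw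
    set PT := push₃ (legChain (respStepBmSeq (d := 3) (toSite rr) Lc) 0 k) (legChain (respStepBmSeq (d := 3) (toSite rr) Lc) 0 k)
      (legChain (respStepBmSeq (d := 3) (toSite rr) Lc) 0 k) (wilsonA 3) with hPT
    set PB := push₃ (respStep (d := 3) 1 (Lc ^ (k + 1))) (respStep (d := 3) 1 (Lc ^ (k + 1))) (respStep (d := 3) 1 (Lc ^ (k + 1)))
      (wilsonA 3) with hPB
    -- split: `w • P_T = w • P_B + w • (P_T − P_B)`
    have eF : (fun κ' u' => w • PT κ' u') = fun κ' u' => w • PB κ' u' + w • (PT κ' u' - PB κ' u') := by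
      funext κ' u'; rw [smul_sub, add_sub_cancel]
    rw [eF]
    -- the undressed part: part A
    have h1 : LocStencil (fun κ' u' => w • PB κ' u') CA δA := hA k
    -- the contact part: `hCT`, packaged, weighted
    have hffD : ∀ κ u, IsFF (PT κ u - PB κ u) := fun κ u => isFF_sub (isFF_push₃ _ _ _ _ κ u) (isFF_push₃ _ _ _ _ κ u)
    have h2 : LocStencil (fun κ u => PT κ u - PB κ u) (K * ((Lc : ℝ) ^ (12 * (k + 1)))⁻¹) (κ' / ((3 : ℝ) + 1)) := by
      refine locStencil_of_ff_bound hffD (by positivity) hκ'.le fun κ u x z α β => ?_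
      rw [Pi.sub_apply, Pi.sub_apply, Pi.sub_apply, Pi.sub_apply]
      exact hC rr hrr k κ u x z α β
    have h2w := locStencil_smul w h2
    have hwK : |w| * (K * ((Lc : ℝ) ^ (12 * (k + 1)))⁻¹) = (Lc : ℝ) ^ (3 + 1) * K := by
      have hw0 : 0 ≤ w := by rw [hw]; subst hcE; positivity
      rw [abs_of_nonneg hw0, hw, hcE]
      have e : ((Lc : ℝ) ^ (3 + 1) * (Lc : ℝ) ^ (2 * (3 + 1))) ^ (k + 1) = (Lc : ℝ) ^ (12 * (k + 1)) := by
        rw [← pow_add, ← pow_mul]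
      rw [e]
      field_simp
    rw [hwK] at h2w
    -- assemble at the common rate
    have h12 := locStencil_add (locStencil_mono' h1 le_rfl hδS_A) (locStencil_mono' h2w le_rfl hδS_κ)
    exact locStencil_mono' h12 (le_max_left _ _) le_rfl

end Four

end Summit.QuantumFields.BalabanUV.Beta.GAN24.WilsonSectorRow

end
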